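import Summits.BirchSwinnertonDyer.BirchSwinnertonDyer.Theorems.KolyvaginRoadThreeRefinedKolyvaginRam
import Summits.BirchSwinnertonDyer.BirchSwinnertonDyer.Theorems.ClassRecordThreeEulerHalvesAtThreeJetchevTight

/-!
# Routes `ClassRecordThree` ∕ `KolyvaginRoadThree` (rung K2@3): on X11b@3 ∧ (ram), `BSD(E,3)` ⟺ the refined
# Kolyvagin conjecture «`M_∞ = t`» at the Hoffstein–Luo frames — the DICTIONARY closed in both directions on the
# tree's objects (cell `bsd-stepL`, seat `bsd-stepL-tam3-p1`, session g2; `--supports stmt-BirchSwinnertonDyer-19109 --as helper`)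

File 4 of this seat (p421279, §8) proved: at ONE odd Heegner datum, a Kolyvagin certificate of level `≤ t + 1`
(`M_∞ ≤ t`) AND global divisibility to depth `t` (`M_∞ ≥ t`) give `BSDp W 3`. File 5 (p424857) identified both
with McCallum's `M_∞` on the tree's objects (`Koly.Minf`) and proved the frame-level converse from the sharp
EQUALITY over `K`. This file closes the circle:

* §1 `certificateAt_of_minf_eq`, `minf_eq_iff_globalDivisibility_and_certificateAt` — DEFINITIONS ONLY: `Koly.Minf
  Dt β ι p = t` ⟺ (J-divisibility to depth `t`) ∧ `Koly.CertificateAt Dt β ι p t` (the infimum is attained: if no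
  datum entering some `M_r` had `ord_p(P_n) = t`, all would have `ord_p ≥ t + 1`).
* §2 `minf_three_eq_of_bsdp` — at every Hoffstein–Luo-type frame (`K` imaginary quadratic Heegner, `d_K` odd,
  `L(E^{d_K},1) ≠ 0`; `(Dt, β, ι)` Manin-good) of a curve `(E,3) ∈` X11b with a (ram) witness: `BSDp W 3` ⟹
  `Koly.Minf Dt β ι 3 = ord₃ ∏ c_ℓ(E)`. Inputs: `BSDp` for `E` + Skinner 2016 Thm. C for the twist (EQUALITY,
  (ram) inherited) + the route's exact Gross–Zagier identity ⟹ the sharp equality over `K` ⟹ file 5 §6.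
* §3 `bsdp_three_of_minf_eq` — conversely `Koly.Minf Dt H.β ι 3 = t` at ONE such datum ⟹ `BSDp W 3` (§1 + file 4 §8).
* §4 `bsdp_ram_iff_refinedKolyvaginHL` — CLASS LEVEL: (`BSDp W 3` for every `(E,3) ∈` X11b with a (ram) witness)
  ⟺ (`M_∞ = t` at every Hoffstein–Luo-type Manin-good frame of every such curve), modulo the published named
  facts (GZ, Kolyvagin, Skinner Thm. C, GZK, modularity, newforms, Hoffstein–Luo, Mazur, Shimura reciprocity,
  Darmon 3.6, McCallum Cor. 5.6 both readings).

HONEST FRAMING. An equivalence between two OPEN class-wide statements (the rung-K2@3 leaf restricted to (ram), and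
W. Zhang's ∕ Jetchev's refined Kolyvagin conjecture at `3 ∥ N`); neither side is proved; nothing is booked; no item
closes. What it settles for the planner: on X11b@3 ∧ (ram) (1 116 A1 + 567 (T2′) TRUE-OPEN classes) the
Kolyvagin road's two cruxes together (koly's Z₃ᵗ = certificate, this seat's J₃ʳ♭ = divisibility) are EXACTLY the
leaf, not a strengthening of it.

References: [McCallumLMS1991] §5 Cor. 5.6; [WZhang2014] Thm. 1.1, Remark 18; [Jetchev2008] Conj. 1.3;
[BurungaleEtAl2026] Thm. 2 (shape); [Skinner2016PacificMC] Thm. C; [JetchevSkinnerWan2017] §7.4; files p421279,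
p424857 (this seat), koly's `KolyvaginLine.lean` ∕ `KolyvaginNonvanishing.lean`.
-/

noncomputable section

open scoped Classical

namespace Summit.BirchSwinnertonDyer.Rank1Residual.X11b.Three.Koly

open WeierstrassCurve Literature.NumberTheory.EllipticCurves
  Literature.NumberTheory.EllipticCurves.ModularForms
  Literature.NumberTheory.EllipticCurves.Rank1Residual
  Summit.BirchSwinnertonDyer.Rank1Residual Summit.BirchSwinnertonDyer.Rank1Residual.X11b

universe u

/-! ### §1 Definitions only: `M_∞ = t` ⟺ divisibility to depth `t` ∧ a certificate of level `t + 1` -/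

section Frame

variable {N : ℕ} [NeZero N] {W : WeierstrassCurve ℚ} [W.IsGloballyMinimal] {K : Type u} [Field K]
  [NumberField K] (Dt : ModularParametrizationData W N) (β : ℤ) (ι : K →+* ℂ) (p : ℕ)

/-- **`M_∞ = t` (finite) yields a certificate of level `t + 1`** (definitions only): if `Koly.Minf Dt β ι p = t`
then some `n ∈ S_r(t+1)` carries a datum with `P_n ∉ p^{t+1} E(K[n])` (`Koly.CertificateAt Dt β ι p t`). Proof:
otherwise every datum entering some `M_r` with `ord_p(P_n) = M` has `M ≠ t` (for `M = t` it would lie in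
`S_r(t+1)` and be `p^{t+1}`-divisible, contradicting `ord_p(P_n) = t`), hence `M ≥ t + 1` since `M ≥ M_∞ = t`;
so `M_∞ ≥ t + 1` — absurd. [cite: McCallumLMS1991, §5 (p. 303) definitions of ord_p(P_n), M_r; Cor. 5.6 (p. 310)] -/
theorem certificateAt_of_minf_eq {t : ℕ} (h : Minf Dt β ι p = (t : ℕ∞)) : CertificateAt Dt β ι p t := by
  by_contra hno
  have hge : ((t + 1 : ℕ) : ℕ∞) ≤ Minf Dt β ι p := by
    simp only [Minf, Mr, le_iInf_iff]
    intro r n d hx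
    obtain ⟨M, hM, hmem⟩ := hx
    -- `M ≥ t` since `M_∞ ≤ ord_p(P_n)`
    have htM : (t : ℕ∞) ≤ (M : ℕ∞) := by
      rw [← h, ← hM]
      exact (iInf_le _ r).trans (iInf_le_of_le n (iInf_le_of_le d (iInf_le_of_le ⟨M, hM, hmem⟩ le_rfl)))
    have htM' : t ≤ M := ENat.coe_le_coe.mp htM
    rw [hM]
    rcases htM'.eq_or_lt with rfl | hlt
    · -- `M = t`: `n ∈ S_r(t+1)` would make `P_n` `p^{t+1}`-divisible
      exfalso
      have hdiv : PDiv d p (t + 1) := by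
        by_contra hnd
        exact hno ⟨n, r, d, hmem, hnd⟩
      have := le_divOrd_of_pDiv p d hdiv
      rw [hM] at this
      exact absurd (ENat.coe_le_coe.mp this) (by omega)
    · exact ENat.coe_le_coe.mpr hlt
  rw [h] at hge
  exact absurd (ENat.coe_le_coe.mp hge) (by omega)

/-- **`M_∞ = t` ⟺ (J-divisibility to depth `t`) ∧ (a certificate of level `t + 1`)** — definitions only; the two
conjuncts are this seat's J₃ and koly's Z₃ᵗ at the frame. [cite: McCallumLMS1991, §5 Cor. 5.6 (p. 310)]
[cite: WZhang2014, Remark 18 (shape of the refined conjecture; nothing used)] -/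
theorem minf_eq_iff_globalDivisibility_and_certificateAt (t : ℕ) :
    Minf Dt β ι p = (t : ℕ∞) ↔
      (∀ (s : ℕ), s ≤ t → ∀ (n : ℕ) (d : KolyvaginHeegnerData Dt β ι n), Squarefree n →
        (∀ ℓ ∈ n.primeFactors, Zhang2014.IsKolyvaginPrime N W K p ℓ ∧
          s ≤ Zhang2014.kolyvaginIndex W p ℓ) → PDiv d p s) ∧ CertificateAt Dt β ι p t :=
  ⟨fun h ↦ ⟨(globalDivisibility_iff_le_minf Dt β ι p t).mpr h.ge, certificateAt_of_minf_eq Dt β ι p h⟩,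
    fun h ↦ minf_eq_of_globalDivisibility_of_certificateAt Dt β ι p t h.1 h.2⟩

end Frame

/-! ### §2 `BSD(E,3)` ⟹ `M_∞ = t` at every Hoffstein–Luo-type frame (X11b@3 ∧ (ram)) -/

/-- **`BSD(E,3)` pins `M_∞ = ord₃ ∏ c_ℓ(E)` at every Hoffstein–Luo-type Manin-good frame** of a curve `(E,3) ∈`
X11b with a (ram) witness. Data: `K` imaginary quadratic Heegner with `d_K` odd and `L(E^{d_K},1) ≠ 0`; a frame
`(Dt, β, ι)` with `4N ∣ β² − d_K`, `3 ∤ c(Dt)`. Inputs: `BSDp W 3` (`hB`); Skinner 2016 Thm. C for the minimal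
twist (`hSk`: the rank-`0` `3`-part EQUALITY; multiplicative `3`, irreducible, (ram) — all inherited); the route's
exact Gross–Zagier identity (`exists_shaAn_padicVal_eq_of_heegner`); GZ, Kolyvagin, GZK, modularity; Shimura
reciprocity + Darmon 3.6 (the conductor-`1` datum descends to the Heegner point); McCallum Cor. 5.6 both readings
(file 5 §6). CONDITIONAL on every binder. [cite: McCallumLMS1991, §5 Cor. 5.6 (p. 310)]
[cite: Skinner2016PacificMC, Thm. C (§1) and footnote 1] [cite: JetchevSkinnerWan2017, §7.4.1 (eq:gz for K′), (eq:tamK)] -/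
theorem minf_three_eq_of_bsdp
    (hGZ : ∀ (N : ℕ) [NeZero N] (W : WeierstrassCurve ℚ) (K : Type) [Field K] [NumberField K],
      gross_zagier N W K)
    (hKo : ∀ (N : ℕ) [NeZero N] (W : WeierstrassCurve ℚ) (K : Type) [Field K] [NumberField K],
      kolyvagin N W K)
    (hSk : Skinner2016.thmC_padicValRat_bsd_rank_zero)
    (hGZK : rank_eq_analyticRank_of_analyticRank_le_one) (hmod : hasEntireLFunction_rat)
    (hrec : ∀ (N : ℕ) [NeZero N] (W : WeierstrassCurve ℚ) (K : Type) [Field K] [NumberField K],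
      heegnerPointOfConductor_one_galoisConj N W K)
    (hD36 : ∀ (N : ℕ) [NeZero N] (W : WeierstrassCurve ℚ) (K : Type) [Field K] [NumberField K],
      phi_heegnerTau_mem_singularModuliField N W K)
    (hMcU : McCallum1991_padicValNat_card_sha_primary_add_le_of_globalDivisibility)
    (hMcL : McCallum1991_pow_dvd_card_sha_primary_of_certificate)
    (W : WeierstrassCurve ℚ) [W.IsElliptic] [W.IsGloballyMinimal] [NeZero (W.conductorNorm ℤ)]
    (K : Type) [Field K] [NumberField K]
    (Dt : ModularParametrizationData W (W.conductorNorm ℤ)) (β : ℤ) (ι : K →+* ℂ)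
    (hX : ClassX11b W 3) (hram : Ram W 3)
    (hK : IsImaginaryQuadratic K) (hodd : Odd (NumberField.discr K))
    (hHN : SatisfiesHeegnerHypothesis (W.conductorNorm ℤ) K)
    (hLt : (W.quadraticTwist (NumberField.discr K : ℚ)).entireLFunction 1 ≠ 0)
    (hβ : (4 * (W.conductorNorm ℤ : ℤ)) ∣ β ^ 2 - NumberField.discr K) (hc : ¬ (3 : ℤ) ∣ Dt.c)
    (hB : BSDp W 3) :
    Minf Dt β ι 3 = (padicValNat 3 W.tamagawaProduct : ℕ∞) := by
  haveI : Fact (Nat.Prime 3) := ⟨Nat.prime_three⟩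
  obtain ⟨hr, h32, hmult, hirr⟩ := hX
  have hρ : Surj W 3 := surj_of_irr_of_ram W 3 hirr hram
  -- a Heegner datum with this β, the K-rational Heegner point, a minimal model of the twist
  obtain ⟨H, hHβ⟩ := nonempty_heegnerDatum_holds (W.conductorNorm ℤ) K hK hβ
  subst hHβ
  obtain ⟨P, hP⟩ := heegnerPointComplex_mem_range_map_holds (W.conductorNorm ℤ) W K hK hHN Dt H ι
  have hD0 : (NumberField.discr K : ℚ) ≠ 0 := by exact_mod_cast NumberField.discr_ne_zero K
  haveI hEt : (W.quadraticTwist (NumberField.discr K : ℚ)).IsElliptic := W.isElliptic_quadraticTwist hD0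
  obtain ⟨Cd, hCd⟩ := hasGlobalMinimalModel_rat_holds (W.quadraticTwist (NumberField.discr K : ℚ))
  haveI : (Cd • W.quadraticTwist (NumberField.discr K : ℚ)).IsGloballyMinimal := hCd
  set Wd := Cd • W.quadraticTwist (NumberField.discr K : ℚ) with hWd'
  have hWd : Cd • W.quadraticTwist (NumberField.discr K : ℚ) = Wd := rfl
  -- `3 ∤ d_K`, `3 ∤ #𝓞_K^×`, `d_K ∉ {−3, −4}`
  obtain ⟨h3d, hμ⟩ := not_dvd_discr_and_not_dvd_torsionOrder_of_heegner hK hHN (p := 3) (by decide)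
    (dvd_conductorNorm_of_classX11b ⟨hr, h32, hmult, hirr⟩)
  have h3 : NumberField.discr K ≠ -3 := fun h ↦ h3d (h ▸ ⟨-1, by norm_num⟩)
  have h4 : NumberField.discr K ≠ -4 := by
    intro h
    rw [h] at hodd
    exact (Int.not_odd_iff_even.mpr ⟨-2, by norm_num⟩) hodd
  -- transports to the twist; Skinner Thm C there (EQUALITY; (ram) inherited)
  have hmultd : Wd.HasMultiplicativeReductionAtPrime 3 :=
    hasMultiplicativeReductionAtPrime_twist_of_heegner' W 3 K hK hHN hmult Cd hWd
  have hirrd : Wd.HasIrreducibleModPGaloisRep 3 := hasIrreducibleModPGaloisRep_twist_model W 3 K hK.1 hirr Cd hWd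
  have hramd : Ram Wd 3 := ram_twist_of_heegner W 3 K hK hHN hram Cd hWd
  have htam : padicValNat 3 Wd.tamagawaProduct = padicValNat 3 W.tamagawaProduct :=
    X2.padicValNat_tamagawaProduct_twist_of_heegner_of_odd W 3 h32 K hK hodd h3d hHN Cd hWd
  have hu : padicValRat 3 (Cd.u : ℚ) = 0 := padicValRat_u_eq_zero_of_twist_minimal W 3 K hK hHN hmult Cd hWd
  have hLt' : (W.quadraticTwist (NumberField.discr K : ℚ)).entireLFunction = Wd.entireLFunction := by
    rw [← hWd, entireLFunction_smul]
  have hLd1 : Wd.entireLFunction 1 ≠ 0 := by rw [← hLt']; exact hLt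
  have hrd : Wd.analyticRank = 0 := (Wd.analyticRank_eq_zero_iff_holds (hmod Wd)).2 hLd1
  have hfinSd : Finite Wd.sha := (hGZK Wd (by omega)).2
  obtain ⟨qd, hqd, hvqd⟩ := hSk Wd 3 le_rfl (Or.inr hmultd) hirrd hramd hLd1 hfinSd
  -- the exact Gross–Zagier identity at the datum
  obtain ⟨hfinW, hfinK, hsha, q, hq, hval⟩ := exists_shaAn_padicVal_eq_of_heegner W 3 (W.conductorNorm ℤ) K Dt
    H ι P (hGZ _ W K) (hKo _ W K) hGZK hmod hK hHN hP h32 hc hμ hr hLt Wd Cd hWd hu qd hqd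
  haveI : Finite W.sha := hfinW
  haveI : Finite (W.baseChange K).sha := hfinK
  -- BSD(E,3): `ord₃ q = ord₃ #Ш(E)`
  obtain ⟨q', hq', hv⟩ := Typed.missingPPartAt_of_bsdp W 3 hB
  have hqq : q' = q := by exact_mod_cast hq'.symm.trans hq
  subst hqq
  -- the sharp EQUALITY over K
  have e1 : (padicValNat 3 (W.baseChange K).shaOrder : ℤ) =
      padicValNat 3 W.shaOrder + padicValNat 3 Wd.shaOrder := by exact_mod_cast hsha
  have e2 : (padicValNat 3 Wd.tamagawaProduct : ℤ) = padicValNat 3 W.tamagawaProduct := by exact_mod_cast htam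
  have heqZ : (padicValNat 3 (W.baseChange K).shaOrder : ℤ) + 2 * padicValNat 3 W.tamagawaProduct =
      2 * padicValNat 3 (AddSubgroup.zmultiples P).index := by omega
  have heq : padicValNat 3 (Nat.card (W.baseChange K).sha) + 2 * padicValNat 3 W.tamagawaProduct =
      2 * padicValNat 3 (AddSubgroup.zmultiples P).index := by exact_mod_cast heqZ
  -- y_K non-torsion, rank one, no 3-torsion; the conductor-1 datum descends to P
  have hPinf : ¬ IsOfFinAddOrder P :=
    not_isOfFinAddOrder_of_heegner_of_analyticRank_eq_one W (W.conductorNorm ℤ) K Dt H ι P (hGZ _ W K) hmod hr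
      hK hHN hLt hP
  obtain ⟨hrank, -⟩ := hKo (W.conductorNorm ℤ) W K hK hHN ⟨Dt, H, ι, hP⟩ hPinf
  have hbot := torsionBy_eq_bot_of_isImaginaryQuadratic_of_hasIrreducibleModPGaloisRep W K hK Nat.prime_three hirr
  have hiv : ∀ x : (W.baseChange K).toAffine.Point, 3 • x = 0 → x = 0 := fun x hx ↦ by
    have hmem : x ∈ AddSubgroup.torsionBy (W.baseChange K).toAffine.Point ((3 : ℕ) : ℤ) := by
      rw [mem_torsionBy_iff, natCast_zsmul]
      exact hx
    rw [hbot] at hmem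
    exact hmem
  obtain ⟨d₁⟩ := exists_kolyvaginHeegnerData_one (hD36 _ W K) hK Dt H.β ι H.dvd_sq_sub
  have hPd : d₁.toGeomPoints d₁.derivedPoint = toGeomPoints (W.baseChange K) P :=
    KolyvaginBottom.toGeomPoints_derivedPoint_one_eq (hrec _ W K) hK hHN hP d₁ rfl
  exact minf_three_eq_of_shaIndexBound_eq hMcU hMcL W K hmult hρ hK h3 h4 hHN Dt H.β ι d₁ P hPd hPinf hrank hiv
    heq

/-! ### §3 Conversely: `M_∞ = t` at ONE Hoffstein–Luo datum ⟹ `BSD(E,3)` -/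

/-- **`M_∞ = t` at one odd Heegner datum gives `BSD(E,3)`** for `(E,3) ∈` X11b with a (ram) witness: §1 splits
`Koly.Minf Dt H.β ι 3 = t` into a level-`(t+1)` certificate and divisibility to depth `t`, and file 4 §8
(`bsdp_three_of_certificateAt_of_globalDivisibility`) concludes. CONDITIONAL on the published binders (GZ,
Kolyvagin, Skinner Thm. C, GZK, modularity, McCallum ×2). [cite: McCallumLMS1991, §5 Cor. 5.6 (p. 310)]
[cite: WZhang2014, Thm. 10.2 and Remark 18 (pp. 245–246) — shape] -/
theorem bsdp_three_of_minf_eq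
    (W : WeierstrassCurve ℚ) [W.IsElliptic] [W.IsGloballyMinimal] [NeZero (W.conductorNorm ℤ)]
    (K : Type) [Field K] [NumberField K]
    (Dt : ModularParametrizationData W (W.conductorNorm ℤ))
    (H : HeegnerDatum (W.conductorNorm ℤ) (NumberField.discr K)) (ι : K →+* ℂ)
    (P : (W.baseChange K).toAffine.Point)
    (hGZ : gross_zagier (W.conductorNorm ℤ) W K) (hKo : kolyvagin (W.conductorNorm ℤ) W K)
    (hSk : Skinner2016.thmC_padicValRat_bsd_rank_zero)
    (hGZK : rank_eq_analyticRank_of_analyticRank_le_one) (hmod : hasEntireLFunction_rat)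
    (hMcL : McCallum1991_pow_dvd_card_sha_primary_of_certificate)
    (hMcU : McCallum1991_padicValNat_card_sha_primary_add_le_of_globalDivisibility)
    (hX : ClassX11b W 3) (hram : Ram W 3)
    (hK : IsImaginaryQuadratic K) (hodd : Odd (NumberField.discr K))
    (hHN : SatisfiesHeegnerHypothesis (W.conductorNorm ℤ) K)
    (hP : WeierstrassCurve.Affine.Point.map ι.toRatAlgHom P = heegnerPointComplex Dt H)
    (hc : ¬ (3 : ℤ) ∣ Dt.c)
    (hLt : (W.quadraticTwist (NumberField.discr K : ℚ)).entireLFunction 1 ≠ 0)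
    (Wd : WeierstrassCurve ℚ) [Wd.IsElliptic] [Wd.IsGloballyMinimal] (Cd : VariableChange ℚ)
    (hWd : Cd • W.quadraticTwist (NumberField.discr K : ℚ) = Wd)
    (d₁ : KolyvaginHeegnerData Dt H.β ι 1)
    (hPd : d₁.toGeomPoints d₁.derivedPoint = toGeomPoints (W.baseChange K) P)
    (hMinf : Minf Dt H.β ι 3 = (padicValNat 3 W.tamagawaProduct : ℕ∞)) : BSDp W 3 := by
  obtain ⟨hglob, hcert⟩ :=
    (minf_eq_iff_globalDivisibility_and_certificateAt Dt H.β ι 3 (padicValNat 3 W.tamagawaProduct)).mp hMinf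
  exact bsdp_three_of_certificateAt_of_globalDivisibility W K Dt H ι P hGZ hKo hSk hGZK hmod hMcL hMcU hX hram hK
    hodd hHN hP hc hLt Wd Cd hWd d₁ hPd hcert le_rfl hglob

/-! ### §4 Class level: `BSD(E,3)` on X11b@3 ∧ (ram) ⟺ `M_∞ = t` at every Hoffstein–Luo frame -/

/-- **On X11b@3 ∧ (ram), `BSD(E,3)` for every curve ⟺ the refined Kolyvagin conjecture «`M_∞ = ord₃ ∏ c_ℓ(E)`»
at every Hoffstein–Luo-type Manin-good frame of every curve** (`K` imaginary quadratic Heegner, `d_K` odd,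
`L(E^{d_K},1) ≠ 0`; `4N ∣ β² − d_K`, `3 ∤ c(Dt)`), modulo the published named facts listed as binders. (⟹) §2;
(⟸) the Hoffstein–Luo datum of the pair (`exists_oddHeegnerData`: newforms, Hoffstein–Luo, Mazur, Néron
scaling), the conductor-`1` datum on its frame (Darmon, Shimura reciprocity), §3. An equivalence of two OPEN
class-wide statements; CONDITIONAL on the binders; nothing asserted about either side; no item closes.
[cite: McCallumLMS1991, §5 Cor. 5.6 (p. 310)] [cite: WZhang2014, Thm. 1.1 and Remark 18]
[cite: Jetchev2008, Conj. 1.3 (p. 812)] [cite: HoffsteinLuo1997, Theorem (§1)] [cite: Darmon2004, Thm. 3.6 (PDF p. 43)] -/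
theorem bsdp_ram_iff_refinedKolyvaginHL
    (hGZ : ∀ (N : ℕ) [NeZero N] (W : WeierstrassCurve ℚ) (K : Type) [Field K] [NumberField K],
      gross_zagier N W K)
    (hKo : ∀ (N : ℕ) [NeZero N] (W : WeierstrassCurve ℚ) (K : Type) [Field K] [NumberField K],
      kolyvagin N W K)
    (hSk : Skinner2016.thmC_padicValRat_bsd_rank_zero)
    (hGZK : rank_eq_analyticRank_of_analyticRank_le_one) (hmod : hasEntireLFunction_rat)
    (hnf : exists_isNewformOf) (hHL : HoffsteinLuo1997_exists_twist_L_one_ne_zero)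
    (hMaz : mazur_not_dvd_maninConstant_of_odd)
    (hrec : ∀ (N : ℕ) [NeZero N] (W : WeierstrassCurve ℚ) (K : Type) [Field K] [NumberField K],
      heegnerPointOfConductor_one_galoisConj N W K)
    (hD36 : ∀ (N : ℕ) [NeZero N] (W : WeierstrassCurve ℚ) (K : Type) [Field K] [NumberField K],
      phi_heegnerTau_mem_singularModuliField N W K)
    (hMcU : McCallum1991_padicValNat_card_sha_primary_add_le_of_globalDivisibility)
    (hMcL : McCallum1991_pow_dvd_card_sha_primary_of_certificate) :
    (∀ (W : WeierstrassCurve ℚ) [W.IsElliptic] [W.IsGloballyMinimal], ClassX11b W 3 → Ram W 3 → BSDp W 3) ↔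
    (∀ (W : WeierstrassCurve ℚ) [W.IsElliptic] [W.IsGloballyMinimal] [NeZero (W.conductorNorm ℤ)]
      (K : Type) [Field K] [NumberField K]
      (Dt : ModularParametrizationData W (W.conductorNorm ℤ)) (β : ℤ) (ι : K →+* ℂ),
      ClassX11b W 3 → Ram W 3 →
      IsImaginaryQuadratic K → SatisfiesHeegnerHypothesis (W.conductorNorm ℤ) K →
      Odd (NumberField.discr K) → (W.quadraticTwist (NumberField.discr K : ℚ)).entireLFunction 1 ≠ 0 →
      (4 * (W.conductorNorm ℤ : ℤ)) ∣ β ^ 2 - NumberField.discr K → ¬ (3 : ℤ) ∣ Dt.c →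
      Minf Dt β ι 3 = (padicValNat 3 W.tamagawaProduct : ℕ∞)) := by
  constructor
  · intro hB W _ _ _ K _ _ Dt β ι hX hram hK hHN hodd hLt hβ hc
    exact minf_three_eq_of_bsdp hGZ hKo hSk hGZK hmod hrec hD36 hMcU hMcL W K Dt β ι hX hram hK hodd hHN hLt hβ hc
      (hB W hX hram)
  · intro hM W _ _ hX hram
    haveI : Fact (Nat.Prime 3) := ⟨Nat.prime_three⟩
    haveI : NeZero (W.conductorNorm ℤ) := ⟨(W.conductorNorm_pos_holds).ne'⟩
    obtain ⟨hr, h32, hmult, hirr⟩ := hX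
    obtain ⟨K, _, _, Dt, H, ι, P, Wd, _, _, Cd, hK, hodd, h3d, hHN, hP, hc, hμ, hLt, hWd⟩ :=
      exists_oddHeegnerData hnf hHL hMaz integral_neronScaling_of_isGloballyMinimal_holds W 3 hr h32 hmult hirr
    obtain ⟨d₁⟩ := exists_kolyvaginHeegnerData_one (hD36 _ W K) hK Dt H.β ι H.dvd_sq_sub
    have hPd : d₁.toGeomPoints d₁.derivedPoint = toGeomPoints (W.baseChange K) P :=
      KolyvaginBottom.toGeomPoints_derivedPoint_one_eq (hrec _ W K) hK hHN hP d₁ rfl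
    exact bsdp_three_of_minf_eq W K Dt H ι P (hGZ _ W K) (hKo _ W K) hSk hGZK hmod hMcL hMcU ⟨hr, h32, hmult, hirr⟩
      hram hK hodd hHN hP hc hLt Wd Cd hWd d₁ hPd
      (hM W K Dt H.β ι ⟨hr, h32, hmult, hirr⟩ hram hK hHN hodd hLt H.dvd_sq_sub hc)

end Summit.BirchSwinnertonDyer.Rank1Residual.X11b.Three.Koly

end
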